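import Mathlib
import Literature.Probability.MarkovChains.TotalVariation
import Summits.Ventures.LatticeQCDFlow.Exactness.FlowMCMC
import Summits.Ventures.LatticeQCDFlow.Scaling.ImportanceWeights
import Summits.Ventures.LatticeQCDFlow.Scaling.Pseudofermions
import Summits.Ventures.LatticeQCDFlow.Scaling.SectorBudget
import Summits.Ventures.LatticeQCDFlow.Scaling.LocalFlows
import Summits.Ventures.LatticeQCDFlow.Scaling.BlockDefect
import Summits.Ventures.LatticeQCDFlow.Scaling.Bhattacharyya
import Summits.Ventures.LatticeQCDFlow.Scaling.CovDefect
import Summits.Ventures.LatticeQCDFlow.Scaling.GaussianWeights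
import Summits.Ventures.LatticeQCDFlow.Scaling.Transport
import Summits.Ventures.LatticeQCDFlow.Scaling.NonEquilibrium

/-!
# LatticeQCDFlow / Scaling — the venture's barrier catalogue entries B1–B4 (+ three supplements)

HONEST FRAMING: exact (Metropolis-corrected) sampling algorithms for lattice gauge theory;
figures of merit are autocorrelation/cost numbers at stated couplings and volumes; no
continuum-physics claim.

Venture `LatticeQCDFlow` (cell pub-lqcd).  The tribunal's T4 barriers of HOME/SCOPING.md §10 /
THEORY-2.md §5, in the tree's barrier-docstring format (`technique_class` / `blocks` /
`because` / `evasions_known` / `scope_caveats` / `status`), each a `def … : Prop` whose body is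
the PROVED mathematical core and each DISCHARGED by a theorem — landed by FANOUT row 31 from
`HOME/THEORY-2-Sketch.lean` v1.4 (theory seat; decls verbatim up to the namespace of row 30's
IMH lemmas, now `Summit.Ventures.LatticeQCDFlow.Exactness`, and bib-key spellings).  These are
OUR results about flow samplers, so they live under the Venture (LEAN PLACEMENT RULE), not under
`Literature/Barriers/`; the printed laws and the physics hypotheses ((U)/(U′) uniform block
defect, (Gβ) Laplace half-mass smallness) live in the docstrings, never in a `def`.

* `VolumeScalingOfTraining` (B1) `:= LocalPushforwardFactorises ∧ KLSuperadditiveFin ∧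
  BlockDefectVolumeLaw ∧ AccBlockDefectVolumeLaw` — `volumeScalingOfTraining`;
* `TopologicalModeCollapse` (B2) — sector mixing-time floor, `topologicalModeCollapse`;
* `ExactnessVsExpressivity` (B3/B5) — the exchange rates ESS ≤ e^{−KL}, acc ≤ 1 − TV,
  `exactnessVsExpressivity`;
* `FermionDeterminantCost` (B4) — joint pseudofermion ESS ≤ gauge-marginal ESS,
  `fermionDeterminantCost`;
* supplements `SectorWeightBudget`, `ConcentrationBudget`, `SectorStickingFloor` (v1.4).
The v1.5 stochastic-flow supplements (`StochasticExactness`, `StochasticEndpointBudget`,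
`PerfectRelaxationLaw`) land with the path-space file (append).
-/

namespace Summit.Ventures.LatticeQCDFlow.Barriers

open Finset

/-- **Barrier (VolumeScalingOfTraining).**  "For fixed models, quality scales exponentially in
volume": `ESS(V) = ESS(V₀)^{V/V₀}` for local flows once `L ≫ ξ_p, ξ_q`
[cite: AbbottEtAl2022Aspects, §V item 4]; `ESS(n_dof) = exp(−k n_dof)` and, for
out-of-equilibrium flows, `exp(−k′ n_dof/n_step)` [cite: BonannoEtAl2026, §3.1];
`P_acc = erfc(√(σ²(ΔS)/8))`, `σ² ∝ V` [cite: Finkenrath2022, eq. (P_acc)]; training configurations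
at fixed τ_int `∝ ξ⁹` in 2-d φ⁴ [cite: DelDebbioMarshRossneyWilson2021, §6].
technique_class: fixed-receptive-field (CNN / masked-coupling / finite-order trivializing-map)
  flows from a product or strong-coupling prior, used as IMH proposal or reweighting density,
  trained by reverse KL at one volume and transferred, OR trained per volume with
  volume-independent depth.
blocks: any route claiming ESS-per-cost or τ_int(Q)-per-cost bounded uniformly in `L/a` at fixed β
  with a flow whose receptive field does not grow with `L`; any cost claim that omits training
  GPU·h amortisation.
because: PROVED `Theory2.essFrac_prodLaw` (ESS multiplicative over independent sub-volumes),
  `Theory2.essFrac_le_exp_neg_kl` (ESS ≤ e^{−KL}), `Theory2.localPushforwardFactorises` /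
  `Theory2.localPushforwardIndep` (light cone: a finite-range flow of a product prior makes
  blocks with disjoint receptive fields independent), `Theory2.klSuperadditiveFin` and
  `Theory2.blockDefectVolumeLaw` (KL ≥ 2δ²·#blocks, so ESS ≤ e^{−2δ²·#blocks},
  `Theory2.ess_blockDefect_volume_law`), `Theory2.accBlockDefectVolumeLaw` (ACCEPTANCE
  ≤ ∏ BC_i² ≤ e^{−δ²·#blocks} in the factorised regime, via `accRate_le_bhatt_sq` and Le Cam's
  `bhatt_sq_le`: BC² ≤ 1 − TV²), `Theory2.gaussian_logweight_ess`
  (ESS = e^{−Var log w} in the Gaussian regime); physics hypothesis (U) (uniform block defect),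
  a theorem at strong coupling, numerically evident elsewhere — NOT part of this `def`; PROVED
  reduction `Theory2.defectFromCorrelation`: δ ≥ |⟨f g⟩_c|/6 for any 1-bounded observables f, g
  on the two halves of a block, so (U) ⇐ one connected cross-cut correlator (e.g. plaquette–
  plaquette) bounded away from 0 uniformly in L.
evasions_known: (i) make the work extensive instead of the quality deficient — NE-MCMC/SNF with
  `n_step ∝ n_dof` (optimum ESS = 1/e, cost `e·k′·n_dof`, PROVED `Theory2.nstep_cost_lower_bound`)
  [cite: BulgarelliCelliniNada2025, §4.2], [cite: BonannoEtAl2026, §4]; (ii) localise the accept/reject —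
  domain-decomposed / hierarchical flows inside multilevel or flow-HMC so that each Metropolis test
  sees `O(block)` not `O(V)` degrees of freedom [cite: Finkenrath2022, §3–4], [cite: AlbandeaEtAl2023,
  §4.3]; (iii) restrict the flowed degrees of freedom to a defect of fixed physical size
  (`n_dof = (L_d/a)³`, independent of `L`) [cite: BonannoEtAl2026, §2–3]; (iv) grow the receptive
  field with `L` (necessary rate ≥ (ξ/4)·log V from T2-I; sufficiency unknown).
scope_caveats: the exponential law is exact only in the factorised regime (T2-B) and a LOWER bound
  elsewhere; it concerns the thermodynamic limit `L/ξ → ∞` at fixed `a`, "it does not obstruct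
  sampling in the continuum limit with L/ξ_p fixed" [cite: AbbottEtAl2022Aspects, §V item 4] —
  the continuum direction is ExactnessVsExpressivity's and TopologicalModeCollapse's business;
  better-than-exponential behaviour is observed when `L/ξ_p` is small (ibid.).
status: printed-law + PROVED mathematical core (this `def` is a theorem, `volumeScalingOfTraining`);
  hypothesis (U) open at intermediate β. -/
def VolumeScalingOfTraining : Prop :=
  Theory2.LocalPushforwardFactorises ∧ Theory2.KLSuperadditiveFin ∧ Theory2.BlockDefectVolumeLaw ∧
    Theory2.AccBlockDefectVolumeLaw

/-- The barrier entry `VolumeScalingOfTraining` is a theorem (discharged from the PROVED cores). [folklore] -/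
theorem volumeScalingOfTraining : VolumeScalingOfTraining :=
  ⟨Theory2.localPushforwardFactorises, Theory2.klSuperadditiveFin, Theory2.blockDefectVolumeLaw,
    Theory2.accBlockDefectVolumeLaw⟩

/-- **Barrier (TopologicalModeCollapse).**  Reverse-KL-trained flows are mode-seeking
("zero-forcing") [cite: DelDebbioMarshRossneyWilson2021, §7.2]; a model that gives a topological
sector `A` weight `q(A) ≪ p(A)` keeps the exact chain EXACT but slow and the reweighting estimator
sample-hungry, and no statistic of model samples detects it: "undersampling of mismodeled regions
may result in an apparently large ESS when the true value may be near zero"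
[cite: AbbottEtAl2022Aspects, App. (ESS)]; detection needs target samples
[cite: NicoliEtAl2023, §III eqs. (19)–(21), Thm 3]; IMH relaxation time `= sup p/q`
[cite: MengersenTweedie1996, Thm 2.1], [cite: Liu1996IMH, Thm 2.1], [cite: Wang2022IMH, Thm 2] (tree: `Literature.Probability.MarkovChains.imh_tvDist_lawAt_le` / `imh_tvDist_lawAt_mode`); `n ≈ exp D_KL(p‖q)`
samples necessary and sufficient [cite: ChatterjeeDiaconis2018, Thm 1.1]; transport maps onto
multimodal targets need bi-Lipschitz constant `≥ σ e^{a²/2σ²}` (1-d, EXACT transport) / infinite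
for disjoint supports [cite: GreniouxEtAl2023, Prop. 3.1], [cite: CornishEtAl2020, Thm 2.1].
technique_class: single global flow from a unimodal/Haar prior + IMH or reweighting, quality
  certified by ESS-hat, acceptance or reverse KL measured on model samples.
blocks: any claim of reduced τ_int(Q) whose evidence is ESS/acceptance alone; any route whose flow
  is trained by reverse KL without a sector-coverage control; any "topology unfrozen" claim at β
  where the HMC reference itself is frozen and no planted control exists.
because: PROVED `Exactness.imhKernel_isStationary` (exactness for every q),
  `Exactness.imh_mixing_lower_bound`, `Exactness.imh_sector_mixing_lower_bound`
  (`t_mix(ε; μ) ≥ (p(A) − μ(A) − ε)/q(A)` for every set A), v1.4 `Exactness.sector_joint_lower_bound`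
  (stationary autocorrelation floor `ρ_t(1_A) ≥ ((1 − q(A)/p(A))₊ᵗ − p(A))/(1 − p(A))`,
  supplement `SectorStickingFloor`) and `Theory2.essFrac_le_essFrac_coarse` (ESS ≤ ESS of the
  sector weights, supplement `SectorWeightBudget`), `Theory2.blindness` +
  `Theory2.bias_restrictLaw` (model-sample diagnostics are blind to deleted sectors on an event of
  probability ≥ q(C)^N while the bias is up to 2 sup|O| p(Cᶜ)); printed necessary sample size
  (Chatterjee–Diaconis).
evasions_known: (i) build the sectors into the prior / protocol instead of the flow — OBC-defect
  priors where Q is not quantised, evolved to PBC by NE-MCMC/SNF with Jarzynski reweighting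
  [cite: BonannoEtAl2026, §5]; (ii) forward-KL / path-gradient or flow-HMC training that uses
  target samples where they exist [cite: NicoliEtAl2023, §V], [cite: AlbandeaEtAl2023]; (iii) mixture /
  sector-conditioned models with explicit sector proposals (cost then moves to estimating
  `p(Q = k)`, i.e. the free-energy differences — no free lunch) [cite: HackettEtAl2021]; (iv) the
  cell's planted-control gate (a flow with a deleted sector must be caught by the analysis code).
scope_caveats: the floor is per start law μ and per ε; it is vacuous when `q(A) ≥ p(A)`
  (over-covering is harmless for mixing, costly only by a constant in acceptance); on a finite
  lattice sectors are not strictly disconnected, and for an ε-APPROXIMATE transport the Lipschitz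
  obstruction is only polynomial in 1/ε (THEORY-2.md v1.1 §3.3 correction of C2); in 2-d
  U(1)/CP^{N−1} toy models the sector weights are computable and the barrier is directly
  measurable.
status: PROVED core (finite state space, `topologicalModeCollapse`) + printed theorems (general
  state space) + conjecture C2 (restated) for the Lipschitz form. -/
def TopologicalModeCollapse : Prop :=
  ∀ (X : Type) [Fintype X] [DecidableEq X] (p q μ : X → ℝ) (A : Finset X) (t : ℕ) (ε : ℝ),
    (∀ x, 0 < p x) → ∑ x, p x = 1 → (∀ x, 0 ≤ q x) → ∑ x, q x = 1 → (∀ x, 0 ≤ μ x) →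
    ∑ x, μ x = 1 →
    Literature.Probability.MarkovChains.tvDist
        (Literature.Probability.MarkovChains.lawAt (Exactness.imhKernel p q) μ t) p ≤ ε →
    (∑ y ∈ A, p y) - (∑ y ∈ A, μ y) - ε ≤ t * ∑ y ∈ A, q y

/-- The barrier entry `TopologicalModeCollapse` is a theorem (discharged from the PROVED cores). [folklore] -/
theorem topologicalModeCollapse : TopologicalModeCollapse :=
  fun _ _ _ _ _ _ A _ _ hp hp1 hq hq1 hμ hμ1 h =>
    Exactness.imh_sector_mixing_lower_bound hp hp1 hq hq1 hμ hμ1 A h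

/-- **Barrier (ExactnessVsExpressivity).**  Exactness is free (Metropolis/reweighting corrects any
model) but converts every defect of the model into COST at a provable exchange rate:
`ESS ≤ exp(−D_KL(p‖q))` (T2-A), acceptance `≤ 1 − ‖p − q‖_TV` (T2-E), `n ≈ exp D_KL` samples
(Chatterjee–Diaconis Thm 1.1), `t_mix ≥ sup-sector p/q` (T2-D); and the expressivity needed to
make the defect small is constrained: exactly trivializing maps exist on a finite lattice
[cite: Luscher2010Trivializing, §1] but the local `t`-expansion has footprint ∝ order and a proved convergence
radius bound that "vanishes in the infinite-volume limit" [cite: Luscher2010Trivializing, §4(b)]; its leading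
order inside HMC leaves the scaling exponent unchanged — "the result is negative"
[cite: EngelSchaefer2011, §6]; fixed architectures reproduce HMC scaling (`z_M = 1.94(6)` vs
`2.19(4)`) [cite: AlbandeaEtAl2023, §4.4]; model quality vs cost trade-offs have no
architecture-independent law [cite: AbbottEtAl2022Aspects, §V items 2–3]; "the precise scaling of
those costs is still unclear" [cite: Kanwar2024, §6].
technique_class: deterministic gauge-equivariant flows (spectral / residual / continuous,
  trivializing-map-inspired) with exact accept/reject, judged by ESS or acceptance at fixed
  (β, L/a).
blocks: claims that a reported ESS/acceptance at (β, L/a) implies a cost advantage without the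
  conversion `cost = (c_flow + c_acc)·2τ_int` resp. `c_flow·N/ESS + C_train/N_total` against the
  HMC baseline at the SAME (β, L/a); claims of β-uniform quality for a fixed-depth flow from the
  Haar prior.
because: PROVED `Theory2.essFrac_le_exp_neg_kl`, `Exactness.accRate_le`,
  `Exactness.imh_sector_mixing_lower_bound`, `Theory2.gaussian_logweight_ess`; v1.4 coupling-law
  core `Theory2.essFrac_le_exp_mul_sqrt` + `Theory2.map_apply_le_of_preimage_le` (ESS ≥ ε from a
  prior of Haar-density ≤ M needs volume contraction `J ≥ ε²/(2e²·M·Haar(E_½))` onto every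
  half-mass set of the target; supplement `ConcentrationBudget`, hypothesis (Gβ)); printed L-1,
  L-2, L-4 of THEORY-2.md §4.
evasions_known: (i) stochastic layers (SNF / NE-MCMC / CRAFT-type annealing) trade expressivity for
  extensive but LINEAR work (T2-F) [cite: BulgarelliCelliniNada2025], [cite: BonannoEtAl2026]; (ii) use the
  flow where the KL to bridge is O(1) by construction: correlated ensembles / derivative
  observables / small parameter shifts [cite: AbbottEtAl2025Progress, §3]; (iii) flow-HMC (field
  transformation inside HMC) where exactness comes from the HMC Metropolis step and the flow only
  needs to reduce forces/autocorrelations [cite: AlbandeaEtAl2023], [cite: EngelSchaefer2011].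
scope_caveats: all exchange rates are inequalities in one direction (defect ⇒ cost); a small
  forward KL does NOT bound τ_int from above without `sup p/q` control (L-2); conjecture C1
  (uniform radius) would, if true, remove the Lüscher-series half of the barrier but not the
  exchange rates.
status: PROVED exchange rates (`exactnessVsExpressivity`) + printed evidence; expressivity half
  partly conjectural (C1, C2). -/
def ExactnessVsExpressivity : Prop :=
  ∀ (X : Type) [Fintype X] [DecidableEq X] (p q : X → ℝ), (∀ x, 0 < p x) → (∀ x, 0 < q x) →
    ∑ x, p x = 1 → ∑ x, q x = 1 →
    Theory2.essFrac p q ≤ Real.exp (-Theory2.klFin p q) ∧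
      Exactness.accRate p q ≤ 1 - Literature.Probability.MarkovChains.tvDist p q

/-- The barrier entry `ExactnessVsExpressivity` is a theorem (discharged from the PROVED cores). [folklore] -/
theorem exactnessVsExpressivity : ExactnessVsExpressivity :=
  fun _ _ _ _ _ hp hq hp1 hq1 => ⟨Theory2.essFrac_le_exp_neg_kl hp hq hp1, Exactness.accRate_le hp1 hq1⟩

/-- **Barrier (FermionDeterminantCost).**  An exact accept/reject or reweighting step for dynamical
fermions needs the RATIO of fermion determinants between proposal and current configuration (flow
proposals are global, so no locality of the ratio can be exploited): exact evaluation is "not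
expected to be scalable … scale cubically with the spacetime volume"
[cite: AbbottEtAl2022Fermions, §I]; the scalable alternative — joint gauge × pseudofermion targets
with a marginal and a conditional flow — is exact but its ESS is bounded by the marginal's:
`ESS_joint ≤ ESS_marginal` (T2-K, PROVED) [cite: AbbottEtAl2022QCD, §3],
[cite: AbbottEtAl2025Progress, §3].
technique_class: flow proposals for the gauge field with fermions integrated out exactly
  (determinant) or stochastically (pseudofermions / noisy estimators) inside an exact correction
  step.
blocks: any dynamical-fermion route that prices the correction step below one global determinant
  ratio (exact) or below `n_pf` full inversions per proposal (stochastic) at the stated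
  (κ or m_q, β, L/a); any ESS quoted without the number of pseudofermion draws.
because: PROVED `Theory2.essFrac_le_essFrac_margU` (χ² divergence cannot increase under
  marginalisation ⇒ joint ESS ≤ marginal ESS; v1.4 generalisation to any coarse-graining
  `Theory2.essFrac_le_essFrac_coarse`); accounting of dense determinant cost; printed numbers
  (THEORY-2.md §3.4).
evasions_known: (i) pseudofermion joint models (linear cost per evaluation, ESS price T2-K)
  [cite: AbbottEtAl2022Fermions]; (ii) tasks where only a determinant RATIO close to 1 is needed —
  correlated ensembles, mass/β derivatives, reweighting in a small parameter
  [cite: AbbottEtAl2025Progress, §3]; (iii) flow-HMC, where fermions enter through standard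
  pseudofermion forces and the exactness is HMC's [cite: AlbandeaEtAl2023]; (iv) domain
  decomposition of the determinant (Schwarz / multilevel factorisations) so that local proposals
  see local factors [cite: Finkenrath2022, §4]; (v) extended-state-space noisy-exact acceptance —
  pseudo-marginal Metropolis–Hastings with a RECYCLED unbiased determinant estimate
  [cite: AlbergoEtAl2021Fermions, §III.A] (after [cite: AndrieuRoberts2009, Thm 1]; tree:
  `Literature.Probability.MarkovChains.PseudoMarginal.exact`) and the Kentucky two-step noisy
  Monte Carlo [cite: LinLiuSloan2000, §II] — exact, with ESS / acceptance bounded by the estimator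
  noise; printed for N_f = 2 Wilson QCD with total cost "at least O(V^{3/2})"
  [cite: JooHorvathLiu2003, §3.5] and the verdict "not particularly efficient"
  [cite: JooHorvathLiu2003, §10].
scope_caveats: the cubic cost is for exact dense evaluation per proposal; unbiased stochastic
  log-det estimators do not give an exact Metropolis test by exponentiation (Jensen bias; tree:
  `Summit.Ventures.LatticeQCDFlow.Exactness.one_lt_mean_of_logUnbiased`) — an exact construction
  (Padé–Z₂ stochastic Tr ln + Bhanot–Kennedy stochastic exponential inside a two-step Metropolis)
  IS printed for QCD [cite: JooHorvathLiu2003, §2–§3] and was found inefficient (evasion (v)); no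
  flow-proposal instance of it is printed; conjecture C5 (locality of the fermionic effective
  action at scale 1/M_π) governs how VolumeScalingOfTraining composes with this barrier.
status: PROVED inequality (`fermionDeterminantCost`) + accounting + printed numbers; C5
  conjectural. -/
def FermionDeterminantCost : Prop :=
  ∀ (U F : Type) [Fintype U] [Fintype F] [Nonempty F] (p q : U × F → ℝ),
    ∑ z, p z = 1 → (∀ z, 0 < q z) → ∑ z, q z = 1 →
    Theory2.essFrac p q ≤ Theory2.essFrac (Theory2.margU p) (Theory2.margU q)

/-- The barrier entry `FermionDeterminantCost` is a theorem (discharged from the PROVED cores). [folklore] -/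
theorem fermionDeterminantCost : FermionDeterminantCost :=
  fun _ _ _ _ _ _ _ hp1 hq hq1 => Theory2.essFrac_le_essFrac_margU hp1 hq hq1

/-! ### v1.4 supplements (gen-3) to the catalogue entries above — same docstring format; the four
barrier `def`s of record are unchanged, these are additional PROVED cores the tribunal may cite
under TopologicalModeCollapse (§5.2) and ExactnessVsExpressivity (§5.3). -/

/-- **Supplement (SectorWeightBudget) to TopologicalModeCollapse / FermionDeterminantCost.**
For every coarse-graining `π : X → Y` of configuration space (topological charge `Q`, Polyakov
sector, any finite-valued order parameter) the reweighting ESS of the model `q` against the target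
`p` is at most the ESS of the induced SECTOR-WEIGHT vectors, and the forward KL at least theirs:
`ESS(p,q) ≤ ESS(π_*p, π_*q) = 1/(1 + χ²(π_*p‖π_*q))`, `D(π_*p‖π_*q) ≤ D(p‖q)`.
technique_class: any flow / mixture / sector-conditioned proposal used with reweighting or IMH,
  judged by ESS.
blocks: claims that a sector-aware architecture removes the topological cost without estimating the
  sector free energies `F_k = −log p(Q = k)` to the accuracy the target ESS demands: with model
  sector weights `q_k` the whole sampler has `ESS ≤ (Σ_k p_k²/q_k)⁻¹` whatever the intra-sector
  quality; two sectors suffice: `ESS ≤ (p_A²/q_A + (1 − p_A)²/(1 − q_A))⁻¹ ≤ q_A/p_A²`, e.g.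
  `p_A = 0.2` modelled at `q_A = 0.02` caps the whole sampler at `ESS ≤ 0.377` (THEORY-2.md §3.3).
because: PROVED `Theory2.essFrac_le_essFrac_coarse`, `Theory2.klFin_coarse_le` (Sedrakyan /
  log-sum per fibre = data processing for χ² and KL [folklore; Polyanskiy–Wu Thm 7.4]).
evasions_known: measure the sector weights with target information (forward-KL / multicanonical /
  OBC-defect + Jarzynski protocols) and feed them to the proposal [cite: BonannoEtAl2026, §5],
  [cite: HackettEtAl2021]; the budget then prices exactly the residual free-energy error.
scope_caveats: an inequality in one direction (sector-weight defect ⇒ ESS loss); matching sector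
  weights exactly does not bound the ESS from below (intra-sector defects remain, T2-A/T2-I).
status: PROVED (`sectorWeightBudget`). -/
def SectorWeightBudget : Prop :=
  ∀ (X Y : Type) [Fintype X] [Fintype Y] [DecidableEq Y] (π : X → Y) (p q : X → ℝ),
    Function.Surjective π → (∀ x, 0 ≤ p x) → ∑ x, p x = 1 → (∀ x, 0 < q x) → ∑ x, q x = 1 →
    Theory2.essFrac p q ≤ Theory2.essFrac (Theory2.coarse π p) (Theory2.coarse π q) ∧
      Theory2.klFin (Theory2.coarse π p) (Theory2.coarse π q) ≤ Theory2.klFin p q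

/-- The barrier entry `SectorWeightBudget` is a theorem (discharged from the PROVED cores). [folklore] -/
theorem sectorWeightBudget : SectorWeightBudget :=
  fun _ _ _ _ _ π _ _ hπ hp hp1 hq hq1 =>
    ⟨Theory2.essFrac_le_essFrac_coarse π hp1 hq hq1 hπ, Theory2.klFin_coarse_le π hp hq⟩

/-- **Supplement (ConcentrationBudget) to ExactnessVsExpressivity — the provable core of the
COUPLING law.**  If the target puts mass `≥ 1/2` on a set `E` then `ESS(p,q) ≤ e·√(2·q(E))`;
combined with `Theory2.map_apply_le_of_preimage_le` (`q(E) ≤ M·J·Haar(E)` for a push-forward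
`q = T_*ν`, prior density `≤ M`, preimage-volume growth `≤ J`), an ESS `≥ ε` from a prior of
bounded density REQUIRES total volume contraction `J ≥ (ε/e)²/(2 M Haar(E_½))` onto every
half-mass set of the target.  For the Wilson action at weak coupling `Haar(E_½) ≤ (c₀/β)^{n_tr/2}`
(hypothesis (Gβ), THEORY-2.md §3.2: Laplace asymptotics of the compact-group integral; exact for
one U(1) plaquette, where `ESS(p_β, Haar) = I₀(β)²/I₀(2β) ∼ (πβ)^{-1/2}`), so
`log J_T ≥ (n_tr/2)·log(β/c₀) − 2·log(e/ε) − log(2M)`: EXTENSIVE × log β.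
technique_class: deterministic flows (any architecture, any depth) from the Haar / strong-coupling
  prior, or from a heat-bath prior at `β₀ < β`, with exact reweighting or IMH.
blocks: claims of β-uniform ESS/acceptance at fixed architecture and fixed total log-Jacobian
  budget; per-layer Jacobian clipping / Lipschitz-regularised flows (bounded `log|det|` per layer
  ⇒ depth `≥ (n_tr/2)·log(β/β₀)/(n_tr·κ)` layers for per-site log-contraction `κ`).
because: PROVED `Theory2.klFin_ge_event`, `Theory2.essFrac_le_exp_mul_rpow`,
  `Theory2.essFrac_le_exp_mul_sqrt`, `Theory2.map_apply_le_of_preimage_le`; (Gβ) printed in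
  substance (Gaussian/Laplace approximation of the Wilson weight at large β) — NOT part of this
  `def`.
evasions_known: (i) start from a heat-bath / HMC-thermalised prior at nearby `β₀` (budget
  `(n_tr/2)·log(β/β₀)`, i.e. β-ladders / annealed and stochastic flows) [cite: BonannoEtAl2026],
  [cite: BulgarelliCelliniNada2025]; (ii) flows whose layers are unboundedly contracting (spline /
  spectral layers) pay the budget in few layers — the bound constrains the TOTAL log-Jacobian, not
  the depth, unless a per-layer cap is imposed (arXiv:2102.06539, Prop. 1: bounded gradients
  ⇒ bounded per-layer log-det).
scope_caveats: necessary, not sufficient, and the half-mass form loses a power: one U(1)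
  plaquette against Haar has `ESS = I₀(β)²/I₀(2β) = 0.143, 0.100, 0.071` at `β = 16, 32, 64`
  (`≈ (πβ)^{-1/2}`), the half-mass bound gives `0.895, 0.751, 0.631` (`∝ β^{-1/4}`), the
  optimised-event bound `Theory2.essFrac_le_exp_mul_rpow` gives `0.486, 0.351, 0.253` (the
  `β^{-1/2}` rate within a factor `3.6`; folder `calib_u1.py`, pure closed forms, no sealed data);
  (Gβ) is a statement about the target alone, checkable by one-link / one-plaquette integrals.
status: PROVED core (`concentrationBudget`) + hypothesis (Gβ) (printed-law level). -/
def ConcentrationBudget : Prop :=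
  ∀ (X : Type) [Fintype X] [DecidableEq X] (p q : X → ℝ) (E : Finset X),
    (∀ x, 0 < p x) → (∀ x, 0 < q x) → ∑ x, p x = 1 → ∑ x, q x = 1 →
    1 / 2 ≤ ∑ x ∈ E, p x → Theory2.essFrac p q ≤ Real.exp 1 * Real.sqrt (2 * ∑ x ∈ E, q x)

/-- The barrier entry `ConcentrationBudget` is a theorem (discharged from the PROVED cores). [folklore] -/
theorem concentrationBudget : ConcentrationBudget :=
  fun _ _ _ _ _ E hp hq hp1 hq1 hE => Theory2.essFrac_le_exp_mul_sqrt E hp hq hp1 hq1 hE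

/-- **Supplement (SectorStickingFloor) to TopologicalModeCollapse — the autocorrelation form.**
For the exact flow-MCMC chain at stationarity and every set `A` of configurations:
`P(X₀ ∈ A, X_t ∈ A) ≥ p(A)·(1 − q(A)/p(A))₊ᵗ`, hence
`ρ_t(1_A) ≥ ((1 − q(A)/p(A))₊ᵗ − p(A))/(1 − p(A))` and `τ_int(1_A) ≳ c(p(A))·p(A)/q(A)`.
technique_class: single global proposal model + IMH, quality certified by MEAN acceptance or
  ESS-hat.
blocks: "topology unfrozen" claims evidenced by mean acceptance / ESS alone: a model with sector
  deficit `q(A)/p(A) = r` has sector-indicator autocorrelation time `≳ 1/r` even at acceptance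
  `1 − O(p(A))`; τ_int(Q) (or of sector indicators) must be reported directly, against a reference
  that resolves the sectors (planted control when HMC is itself frozen).
because: PROVED `Exactness.sector_persistence_lower_bound`, `Exactness.sector_joint_lower_bound`
  (holding probability `≥ 1 − q(x)/p(x)` = `Exactness.imhKernel_diag_ge`, staying put is a `t`-step
  path, Jensen over `A`); complements the mixing-time form `Exactness.imh_sector_mixing_lower_bound`.
evasions_known: as TopologicalModeCollapse (i)–(iv).
scope_caveats: one-sided (deficit ⇒ sticking); vacuous when `q(A) ≥ p(A)`; it bounds the indicator
  observable `1_A`, not every observable (the "for all observables" rejection-run identity of the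
  flow-MCMC literature is not a theorem for general observables, THEORY-2.md E4).
status: PROVED (`sectorStickingFloor`). -/
def SectorStickingFloor : Prop :=
  ∀ (X : Type) [Fintype X] [DecidableEq X] (p q : X → ℝ) (A : Finset X) (t : ℕ),
    (∀ x, 0 < p x) → ∑ x, p x = 1 → (∀ x, 0 ≤ q x) → ∑ x, q x = 1 → 0 < ∑ x ∈ A, p x →
    (∑ x ∈ A, p x) * (max 0 (1 - (∑ x ∈ A, q x) / (∑ x ∈ A, p x))) ^ t
      ≤ ∑ x ∈ A, ∑ y ∈ A, p x *
          Literature.Probability.MarkovChains.lawAt (Exactness.imhKernel p q) (Pi.single x 1) t y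

/-- The barrier entry `SectorStickingFloor` is a theorem (discharged from the PROVED cores). [folklore] -/
theorem sectorStickingFloor : SectorStickingFloor :=
  fun _ _ _ _ _ A t hp hp1 hq hq1 hA => Exactness.sector_joint_lower_bound hp hp1 hq hq1 A hA t

end Summit.Ventures.LatticeQCDFlow.Barriers
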